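import Mathlib
import HarnessLib
import Summits.HubbardSuperconductivity.HubbardSuperconductivity.Theorems.KLProgrammeKLRegimeSplitTwoLegCoreTDZero
import Summits.HubbardSuperconductivity.HubbardSuperconductivity.Theorems.KLProgrammeKLRegimeEngineV8DefsG5

/-!
# Route `KLProgramme` — GEN-6 ENGINE child (`klPredsV15`, package `klEngGeo5`/`klEngQ5`): the two-leg CoreT closers in the gen-6 stubs' LITERAL binders

Cell `gate-hubbard-kl`, seat p1b (g7).  The gen-6 engine skeleton (plan g14 (R12)/(R11) FINAL; registrant p1 g9) keeps the Q5 thresholds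
(`c ≤ klEngC₃3 P R`, `U ≤ klEngU₀3 P R c`, `klEngL₃ β U ≤ L`), takes `G := klEngGeo5`, `Q := klEngQ5 P R`, and binds the two-leg stubs' frame by
`FrameOKDeg R U (nScales β) μ K`.  These are the `_stub6` twins of `…TwoLegCoreTDZero` / `…TwoLegCoreTMomentum` in exactly those binders:

* **`twoLegCoreTD_zero_of_momentumSizes_stub6`** — `TwoLegCoreTD L M hist klEngGeo5 P (klEngQ5 P R) R β U μ K 0` from the momentum-side sizes of
  `σ₀ − K∘p` (k ≤ 2), the capped response `ρ₀`, the field strength on the shell, three fits; no aliasing term;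
* **`twoLegCoreTD_succ_of_momentumSizes_stub6`** — `TwoLegCoreTD … K (n+1)` from the increment's momentum-side sizes, the increment response, the
  K-separated gradient of `S_{n+1}` (no aliasing term either: the frame is capped), the field strength, fits.

Proofs only; nothing about the model is asserted.  References: BGM 2006 §2.4 (2.36) [cite: BenfattoGiulianiMastropietro2006].
-/

noncomputable section

namespace Summit.HubbardSuperconductivity.HubbardSuperconductivity.Theorems.KLRegimeSplit

set_option linter.dupNamespace false -- summit = problem name (single-conjunct summit), D-0017

open Real Finset
open Literature.MathematicalPhysics.QuantumLattice Literature.MathematicalPhysics.QuantumLattice.BandSectorCounting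
open Literature.Probability.LatticeModels
open Summit.HubbardSuperconductivity.HubbardSuperconductivity.Theorems.DispersionFlow
open Summit.HubbardSuperconductivity.HubbardSuperconductivity.Theorems.PerturbedFermiCurve
open Summit.HubbardSuperconductivity.HubbardSuperconductivity.Theorems.KLProgrammeLegKernels
open Summit.HubbardSuperconductivity.HubbardSuperconductivity.Theorems.TwoLegFourier
open Summit.HubbardSuperconductivity.HubbardSuperconductivity.Theorems.EngineV8

variable {L M : ℕ} [NeZero L] [NeZero M]

/-- **Gen-6 stub-keyed, scale 0**: `TwoLegCoreTD L M hist klEngGeo5 P (klEngQ5 P R) R β U μ K 0` for a capped frame at an engine volume. -/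
theorem twoLegCoreTD_zero_of_momentumSizes_stub6 (P : SplitConsts) {R : RenConsts} (hRW : R.WF2) {c : ℝ} (hc : 0 < c)
    (hcle : c ≤ klEngC₃3 P R) {U : ℝ} (hU : 0 < U) (hUle : U ≤ klEngU₀3 P R c) {β : ℝ} (hβmin : klBetaMin ≤ β)
    (hβc : β ≤ Real.exp (c / U ^ 2)) {μ : ℝ} (hμ : μ ∈ klWindowC) {K : TrigPolyC4v} (hKD : FrameOKDeg R U (nScales β) μ K)
    (hL : klEngL₃ β U ≤ L) (hist : TrigPolyC4v → ℕ → Prop) {m : ℕ → ℝ}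
    (hm : ∀ k ≤ 2, ∀ p : Momentum, ‖iteratedFDeriv ℝ k
      (evalM (symInterp L (fun q => klLocSelfEnergyRe L M β U μ K 0 q - K.eval (latticeMomentum L q)))) p‖ ≤ m k)
    (hfitS : ∀ j ≤ 2, (if j = 0 then m 0 else 0) +
      (j.factorial : ℝ) ^ 2 * (2 * j.factorial * 1110 * 200 ^ j) *
        (if j = 0 then 2 * m 0 else (2 * π + 1) * (m 1 * klCurveD1) + (if j = 2 then m 2 * klCurveD1 ^ 2 + m 1 * klCurveD2 else 0)) *
        (4 + max 1 (((j - 1).factorial : ℝ) / (8 / 5))) ^ j ≤ twoLegBar klEngGeo5 (klEngQ5 P R) U j 0)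
    {ρ₀ : ℝ}
    (hr₀ : ∀ K' : TrigPolyC4v, FrameOKDeg R U (klTempScaleIdx β klE0) μ K' → ∀ θ : ℝ,
      |((symInterp L (klLocSelfEnergyRe L M β U μ K 0)).eval (klFermiPoint μ K' θ) - K.eval (klFermiPoint μ K' θ)) -
        ((symInterp L (klLocSelfEnergyRe L M β U μ K' 0)).eval (klFermiPoint μ K' θ) - K'.eval (klFermiPoint μ K' θ))| ≤
        ρ₀ * frameDist K K')
    (hfitL : ρ₀ + m 1 / klCurveD ≤ lipBar klEngGeo5 (klEngQ5 P R) U 0)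
    (hz : ∀ k ∈ klShell L μ K 0, |klFieldStrength L M β U μ K 0 k - 1| ≤ R.cz * |U|)
    (hfit1 : m 1 + 4 / 3 * R.Gfr 1 * U ^ 2 ≤ R.cz * |U| * (cDtmin (-1.2) (-0.05) / 2)) :
    TwoLegCoreTD L M hist klEngGeo5 P (klEngQ5 P R) R β U μ K 0 :=
  have hR : ∀ j, 0 ≤ R.Gfr j := hRW.1.2.2
  twoLegCoreTD_zero_of_momentumSizes_degCap (L := L) (M := M) hR hc (hcle.trans (klEngC₃3_le_klCurveC3 P hR)) hU
    (hUle.trans (klEngU₀3_le_klCurveU0 P hR c)) hβmin hβc hμ hKD hL hist klEngGeo5 P (klEngQ5 P R) hm hfitS hr₀ hfitL hz hfit1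

/-- **Gen-6 stub-keyed, scale `n + 1`**: `TwoLegCoreTD L M hist klEngGeo5 P (klEngQ5 P R) R β U μ K (n+1)` for a capped frame at an engine volume
(the aliasing size `a₁` of the (E3e) gradient is `0` by exact reproduction). -/
theorem twoLegCoreTD_succ_of_momentumSizes_stub6 (P : SplitConsts) {R : RenConsts} (hRW : R.WF2) {c : ℝ} (hc : 0 < c)
    (hcle : c ≤ klEngC₃3 P R) {U : ℝ} (hU : 0 < U) (hUle : U ≤ klEngU₀3 P R c) {β : ℝ} (hβmin : klBetaMin ≤ β)
    (hβc : β ≤ Real.exp (c / U ^ 2)) {μ : ℝ} (hμ : μ ∈ klWindowC) {K : TrigPolyC4v} (hKD : FrameOKDeg R U (nScales β) μ K)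
    (hL : klEngL₃ β U ≤ L) (hist : TrigPolyC4v → ℕ → Prop) (n : ℕ) {Mv : ℕ → ℝ}
    (hM : ∀ k ≤ 2, ∀ p : Momentum, ‖iteratedFDeriv ℝ k
      (evalM (symInterp L fun q => klLocSelfEnergyRe L M β U μ K (n + 1) q - klLocSelfEnergyRe L M β U μ K n q)) p‖ ≤ Mv k)
    (hfitS : ∀ j ≤ 2, (if j = 0 then Mv 0 else 0) +
      (j.factorial : ℝ) ^ 2 * (2 * j.factorial * 1110 * 200 ^ j) *
        (if j = 0 then 2 * Mv 0 else (2 * π + 1) * (Mv 1 * klCurveD1) + (if j = 2 then Mv 2 * klCurveD1 ^ 2 + Mv 1 * klCurveD2 else 0)) *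
        (4 + max 1 (((j - 1).factorial : ℝ) / (8 / 5))) ^ j ≤ twoLegBar klEngGeo5 (klEngQ5 P R) U j (n + 1))
    {ρΔ : ℝ}
    (hr : ∀ K' : TrigPolyC4v, FrameOK R U (klTempScaleIdx β klE0) μ K' → (∀ j < n + 1, hist K' j) → ∀ θ : ℝ,
      |((symInterp L (klLocSelfEnergyRe L M β U μ K (n + 1))).eval (klFermiPoint μ K' θ) -
          (symInterp L (klLocSelfEnergyRe L M β U μ K n)).eval (klFermiPoint μ K' θ)) -
        ((symInterp L (klLocSelfEnergyRe L M β U μ K' (n + 1))).eval (klFermiPoint μ K' θ) -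
          (symInterp L (klLocSelfEnergyRe L M β U μ K' n)).eval (klFermiPoint μ K' θ))| ≤ ρΔ * frameDist K K')
    (hfitL : ρΔ + Mv 1 / klCurveD ≤ lipBar klEngGeo5 (klEngQ5 P R) U (n + 1))
    {m₁' : ℝ}
    (hm₁' : ∀ p : Momentum, ‖iteratedFDeriv ℝ 1
      (evalM (symInterp L (fun q => klLocSelfEnergyRe L M β U μ K (n + 1) q - K.eval (latticeMomentum L q)))) p‖ ≤ m₁')
    (hz : ∀ k ∈ klShell L μ K (n + 1), |klFieldStrength L M β U μ K (n + 1) k - 1| ≤ R.cz * |U|)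
    (hfit1 : m₁' + 4 / 3 * R.Gfr 1 * U ^ 2 ≤ R.cz * |U| * (cDtmin (-1.2) (-0.05) / 2)) :
    TwoLegCoreTD L M hist klEngGeo5 P (klEngQ5 P R) R β U μ K (n + 1) := by
  have hR : ∀ j, 0 ≤ R.Gfr j := hRW.1.2.2
  have hdeg : K.degree ≤ L / 2 := hKD.degree_le_half rfl hβmin hL
  have ha₁ : ∀ p : Momentum, ‖iteratedFDeriv ℝ 1
      (fun p : Momentum => evalM (symInterp L (fun q => K.eval (latticeMomentum L q))) p - evalM K p) p‖ ≤ 0 := fun p => by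
    rw [iteratedFDeriv_symInterp_latticeValues_sub_eq_zero L K hdeg 1 p, norm_zero]
  exact twoLegCoreTD_succ_of_momentumSizes (L := L) (M := M) hR hc (hcle.trans (klEngC₃3_le_klCurveC3 P hR)) hU
    (hUle.trans (klEngU₀3_le_klCurveU0 P hR c)) hβmin hβc hμ hKD.1 hist klEngGeo5 P (klEngQ5 P R) n hM hfitS hr hfitL hm₁' ha₁ hz
    (by simpa only [add_zero] using hfit1)

end Summit.HubbardSuperconductivity.HubbardSuperconductivity.Theorems.KLRegimeSplit

end
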